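import Literature.MathematicalPhysics.QuantumFieldTheory.Balaban1983to89.B4PartitionUnity22

/-!
# `Balaban1983to89.B4Eq26Locality` — [Balaban1983RegularityDecay] (2.6) p. 576 «(−Δ^{η,N}_{A,Ω})h_jG(□_j,Ã_j) =
(−Δ^{η,N}_{Ã_j,□_j})h_jG(□_j,Ã_j)» PROVED for the concrete partition of unity of `B4PartitionUnity22`, and the
parametrix identity (2.9)–(2.11) `H·G₀ = 1 − R` for [B4]'s concrete `G₀` with both structural hypotheses discharged

statement-level skeleton of published theorems with citation tags; proofs where landed; nothing here is a claim about the Yang–Mills mass gap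

CITATION HEADER.  T. Bałaban, *Regularity and decay of lattice Green's functions*, Commun. Math. Phys. **89** (1983)
571–597, doi:10.1007/bf01214744 [Balaban1983RegularityDecay] (cell paper B4; held text
`paper:balaban1983-cmp89-regularity-decay`, journal page = PDF page + 570; p. 576 read from the page render
`b2b-balaban-ref1/pages/1983-cmp89-regularity-decay/…-p006-x2.png`).  Unit `lit-balaban-r01` gen 5 (B4 fold owner),
HOME `run/shared/lean/pub/lit-balaban/`, SKELETON rows **B4.Eq2.2** (G₀, (2.2)), **B4.Eq2.10** ((2.10)–(2.11)),
**B4.Eq2.12** and **B4.Def§2**; companion of `B4Eq213Locality` (the (2.13) support fact).  Theorems only; imports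
`B4PartitionUnity22` (→ `B4Commutators25to211` → `B4GaugeCovariance`).

WHAT IS PRINTED (verbatim, p. 576).  *«Special care has to be taken in considering boundary terms. Let us remark now
that (−Δ^{η,N}_{A,Ω})h_jG(□_j, Ã_j) = (−Δ^{η,N}_{Ã_j,□_j})h_jG(□_j, Ã_j), (2.6) because the function h_j can be ≠ 0 only on
the part of the boundary of □_j which is contained in the boundary of Ω.»*; p. 575: *«if □_j is an interior cube of
Ω, then we take Ã_j as equal to A on the cube {x : |x − Mj| ≤ ¾M}, and changing regularly to a constant function in a
neighbourhood of a boundary of □_j»*; (2.9)–(2.11) p. 576 (the parametrix computation, typed abstractly as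
`B4Commutators25to211.parametrix_identity` with hypotheses `hloc` = (2.6), `hG` = `H_jG_j = 1`, `hsum` = `Σ_j h_j² = 1`).

WHAT THIS MODULE PROVES (all in full; generic finite site set `X` with positions `pos : X → ℝ^d`, internal index `κ`,
block index `Y`; the operator (1.6) `H = covOp c m² a q W T = −Δ_W + m² + aQ^*Q` of `B4GaugeCovariance`).
* §1 AGREEMENT AFTER MULTIPLICATION BY `h` (the mechanism of (2.6)): `blockOp_mul_mulH_congr` (only kernel columns on
  `supp h` matter), `covLapKer_congr` / `covLap_mul_mulH_congr` (the column of `−Δ_W` at `z′` depends only on the bonds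
  AT `z′`), `projOp_mul_mulH_congr` (`Q^*Q`: only the blocks meeting `supp h`), `covOp_mul_mulH_congr` (`H·h = H′·h`
  when the two data agree on the bonds and blocks at `supp h`).
* §2 (2.6) FOR THE CONCRETE `h_j = B4PartitionUnity22.hCube M j ∘ pos`: `mem_plateau_of_near_supp` (a site within
  `M/8` of `supp h_j ⊂ {|x − Mj|_∞ < (5/8)M}` lies in the plateau `{|x − Mj|_∞ ≤ (3/4)M}` where `Ã_j = A`),
  `covOp_mul_mulH_hCube_congr` (`H·h_j = H′·h_j` for data local at scale `M/8` agreeing on the plateau),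
  `neumannCut_agrees` (the NEUMANN CUT `1[z ∈ S ↔ z′ ∈ S]·c(z,z′)` at any site set `S ⊇ (7/8)M`-cube — in [B4] the
  sites of `□_j` — agrees with `c` at every plateau site), **`eq26_hCube`** ((2.6) as printed: `H(Ω,A)·h_j =
  H(□_j,Ã_j)·h_j` with `□_j` = Neumann cut at `S`, `Ã_j` = any links/transporters equal to `A`'s on the plateau).
* §3 **`parametrix_identity_hCube`** — (2.9)–(2.11) `H·Σ_j h_jG_jh_j = 1 − Σ_j K_jG_jh_j` (`K_j = [h_j, H_j]` =
  `B4Commutators25to211.opK`) for [B4]'s concrete `G₀` (2.2), with `hsum` (by `B4PartitionUnity22.sum_mulH_hCube_sq_eq_one`)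
  and `hloc` (by `eq26_hCube`) DISCHARGED — the only hypothesis left is `H_j·G_j = 1` (the cube propagators exist).

HONEST SCOPE.  (i) `□_j` is modelled as a Neumann cut of the bond weights at an arbitrary site set `S_j` containing the
`(7/8)M`-neighbourhood of `Mj` (print: `□_j = Ω ∩` the `2M`-cube; any such choice satisfies (2.6)); the cut operator
acts on all of `X` and decouples `S_j` from its complement, so `h_jG_jh_j` only sees the `S_j`-block `G_k(□_j,Ã_j)`.
(ii) `Ã_j` enters only through the agreement of links/transporters on the plateau; its construction `A₀ + θ_jA′` is
`B4PartitionUnity22.thetaCube` and is not needed for (2.6).  (iii) The averaging blocks are kept (`q′ = q`): in [B4]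
the unit blocks inside `□_j` are unchanged and those outside never meet `supp h_j`.  (iv) Locality scale: bonds and
blocks of range `≤ M/8` (in [B4]: range `η ≤ 1` resp. `< 1` in `η`-units of the unit lattice, so `M ≥ 8` suffices —
«M sufficiently large»).  Nothing analytic; no `def`, no `Prop` fact, no `sorry`; axioms standard.
-/

namespace Literature.MathematicalPhysics.QuantumFieldTheory.Balaban1983to89.B4Eq26Locality

open Literature.MathematicalPhysics.QuantumFieldTheory.Balaban1983to89.B4GaugeCovariance
open Literature.MathematicalPhysics.QuantumFieldTheory.Balaban1983to89.B4Commutators25to211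
open Literature.MathematicalPhysics.QuantumFieldTheory.Balaban1983to89.B4PartitionUnity22
open scoped Matrix

variable {X Y κ ι : Type*} [Fintype X] [Fintype Y] [Fintype κ] [DecidableEq X] [DecidableEq κ] [Fintype ι]

/-! ## §1. Agreement of operators after multiplication by `h`: only the kernel columns on `supp h` matter -/

/-- two block operators followed by the multiplication operator `h` agree as soon as their kernel COLUMNS agree on
`supp h`. [cite: Balaban1983RegularityDecay, (2.6) p.576] -/
theorem blockOp_mul_mulH_congr (K K' : X → X → Matrix κ κ ℝ) (h : X → ℝ)
    (hK : ∀ z z', h z' ≠ 0 → K z z' = K' z z') :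
    blockOp K * mulH (ι := κ) h = blockOp K' * mulH (ι := κ) h := by
  rw [blockOp_mul_mulH, blockOp_mul_mulH]
  congr 1
  funext z z'
  by_cases h0 : h z' = 0
  · rw [h0, zero_smul, zero_smul]
  · rw [hK z z' h0]

omit [Fintype κ] [DecidableEq κ] in
/-- scalar-times-block terms agree if the scalars agree and the blocks agree where the scalar is nonzero. [folklore] -/
private theorem smul_congr_of {r r' : ℝ} {A B : Matrix κ κ ℝ} (hr : r = r') (hA : r ≠ 0 → A = B) :
    r • A = r' • B := by
  subst hr
  by_cases h0 : r = 0
  · rw [h0, zero_smul, zero_smul]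
  · rw [hA h0]

/-- LOCALITY OF `−Δ_W` (the mechanism of (2.5)/(2.6)): the kernel column of `−Δ_W` at the site `z′` depends only on
the bonds AT `z′` — their weights `c(·,z′)`, `c(z′,·)` and link variables. [cite: Balaban1983RegularityDecay, (2.6) p.576] -/
theorem covLapKer_congr {c c' : X → X → ℝ} {W W' : X → X → Matrix κ κ ℝ} (z' : X)
    (hcol : ∀ x, c x z' = c' x z' ∧ c z' x = c' z' x)
    (hW1 : ∀ x, c x z' ≠ 0 → W x z' = W' x z') (hW2 : ∀ x, c z' x ≠ 0 → W z' x = W' z' x) (z : X) :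
    covLapKer c W z z' = covLapKer c' W' z z' := by
  unfold covLapKer
  by_cases hz : z = z'
  · subst hz
    rw [if_pos rfl, if_pos rfl, if_pos rfl, if_pos rfl]
    have h1 : ∑ x, c x z • ((W x z)ᵀ * W x z) = ∑ x, c' x z • ((W' x z)ᵀ * W' x z) :=
      Finset.sum_congr rfl fun x _ => smul_congr_of (hcol x).1 fun hx => by rw [hW1 x hx]
    have h2 : c z z • (W z z)ᵀ = c' z z • (W' z z)ᵀ := smul_congr_of (hcol z).1 fun hx => by rw [hW1 z hx]
    have h3 : c z z • W z z = c' z z • W' z z := smul_congr_of (hcol z).1 fun hx => by rw [hW1 z hx]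
    have h4 : ∑ y, c z y • (1 : Matrix κ κ ℝ) = ∑ y, c' z y • (1 : Matrix κ κ ℝ) :=
      Finset.sum_congr rfl fun y _ => by rw [(hcol y).2]
    rw [h1, h2, h3, h4]
  · rw [if_neg hz, if_neg hz, if_neg hz, if_neg hz]
    have h2 : c z' z • (W z' z)ᵀ = c' z' z • (W' z' z)ᵀ := smul_congr_of (hcol z).2 fun hx => by rw [hW2 z hx]
    have h3 : c z z' • W z z' = c' z z' • W' z z' := smul_congr_of (hcol z).1 fun hx => by rw [hW1 z hx]
    rw [h2, h3]

/-- `−Δ_W·h = −Δ′_{W′}·h` whenever the bonds at the sites of `supp h` (weights and links) are the same for the two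
data — the content of «(−Δ^{η,N}_{A,Ω})h_j… = (−Δ^{η,N}_{Ã_j,□_j})h_j…, because the function h_j can be ≠ 0 only on the
part of the boundary of □_j which is contained in the boundary of Ω». [cite: Balaban1983RegularityDecay, (2.6) p.576] -/
theorem covLap_mul_mulH_congr {c c' : X → X → ℝ} {W W' : X → X → Matrix κ κ ℝ} (h : X → ℝ)
    (hcol : ∀ z', h z' ≠ 0 → ∀ x, c x z' = c' x z' ∧ c z' x = c' z' x)
    (hW : ∀ z', h z' ≠ 0 → ∀ x, (c x z' ≠ 0 → W x z' = W' x z') ∧ (c z' x ≠ 0 → W z' x = W' z' x)) :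
    covLap c W * mulH (ι := κ) h = covLap c' W' * mulH (ι := κ) h := by
  rw [covLap_eq_blockOp, covLap_eq_blockOp]
  exact blockOp_mul_mulH_congr _ _ h fun z z' hz' =>
    covLapKer_congr z' (hcol z' hz') (fun x => (hW z' hz' x).1) (fun x => (hW z' hz' x).2) z

/-- `Q^*Q·h = Q′^*Q′·h` whenever every averaging block MEETING `supp h` is the same for the two data (weights, and
transporters where the weight is nonzero). [cite: Balaban1983RegularityDecay, (2.6) p.576] -/
theorem projOp_mul_mulH_congr {q q' : Y → X → ℝ} {T T' : Y → X → Matrix κ κ ℝ} (h : X → ℝ)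
    (hq : ∀ y z', h z' ≠ 0 → (q y z' ≠ 0 ∨ q' y z' ≠ 0) → ∀ x, q y x = q' y x ∧ (q y x ≠ 0 → T y x = T' y x)) :
    projOp q T * mulH (ι := κ) h = projOp q' T' * mulH (ι := κ) h := by
  rw [projOp_eq_blockOp, projOp_eq_blockOp]
  refine blockOp_mul_mulH_congr _ _ h fun z z' hz' => ?_
  refine Finset.sum_congr rfl fun y _ => ?_
  by_cases hy : q y z' = 0 ∧ q' y z' = 0
  · rw [hy.1, hy.2, mul_zero, mul_zero, zero_smul, zero_smul]
  · have hy' : q y z' ≠ 0 ∨ q' y z' ≠ 0 := not_and_or.mp hy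
    have hag := hq y z' hz' hy'
    refine smul_congr_of (by rw [(hag z).1, (hag z').1]) fun hne => ?_
    obtain ⟨h1, h2⟩ := mul_ne_zero_iff.mp hne
    rw [(hag z).2 h1, (hag z').2 h2]

/-- **(2.6) in operator form**: `H·h = H′·h` for the operators `H = −Δ_W + m² + aQ^*Q` (1.6) of two data sets which
agree on the bonds and blocks at `supp h` — the hypothesis `hloc` (`H * mulH(h_j) = H_j * mulH(h_j)`) of
`B4Commutators25to211.parametrix_identity` / `green_eq_G0_mul_of_inv`. [cite: Balaban1983RegularityDecay, (2.6) p.576] -/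
theorem covOp_mul_mulH_congr {c c' : X → X → ℝ} {W W' : X → X → Matrix κ κ ℝ} {q q' : Y → X → ℝ}
    {T T' : Y → X → Matrix κ κ ℝ} (m2 a : ℝ) (h : X → ℝ)
    (hcol : ∀ z', h z' ≠ 0 → ∀ x, c x z' = c' x z' ∧ c z' x = c' z' x)
    (hW : ∀ z', h z' ≠ 0 → ∀ x, (c x z' ≠ 0 → W x z' = W' x z') ∧ (c z' x ≠ 0 → W z' x = W' z' x))
    (hq : ∀ y z', h z' ≠ 0 → (q y z' ≠ 0 ∨ q' y z' ≠ 0) → ∀ x, q y x = q' y x ∧ (q y x ≠ 0 → T y x = T' y x)) :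
    covOp c m2 a q W T * mulH (ι := κ) h = covOp c' m2 a q' W' T' * mulH (ι := κ) h := by
  unfold covOp
  simp only [Matrix.add_mul, Matrix.smul_mul]
  rw [covLap_mul_mulH_congr h hcol hW, projOp_mul_mulH_congr h hq]

/-! ## §2. (2.6) for the concrete partition of unity `h_j`: Neumann cut at `□_j` and field change on the `θ_j`-plateau -/

omit [Fintype X] [DecidableEq X] in
/-- geometry: a site within `(1/8)M` (every coordinate) of a point of `supp h_j` lies in the plateau cube
`{|x_μ − Mj_μ| ≤ (3/4)M}` (where `θ_j = 1`, `Ã_j = A`). [cite: Balaban1983RegularityDecay, §2 p.575] -/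
theorem mem_plateau_of_near_supp {M : ℝ} (hM : 0 < M) (pos : X → ι → ℝ) {j : ι → ℤ} {z' x : X}
    (hz' : hCube M j (pos z') ≠ 0) (hx : ∀ μ, |pos x μ - pos z' μ| ≤ 1 / 8 * M) (μ : ι) :
    |pos x μ - M * j μ| ≤ 3 / 4 * M := by
  have h1 := hCube_ne_zero_imp hM hz' μ
  have h2 := hx μ
  calc |pos x μ - M * j μ| = |(pos x μ - pos z' μ) + (pos z' μ - M * j μ)| := by ring_nf
    _ ≤ |pos x μ - pos z' μ| + |pos z' μ - M * j μ| := abs_add_le _ _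
    _ ≤ 3 / 4 * M := by linarith

omit [Fintype X] [DecidableEq X] in
/-- a point of `supp h_j` itself lies in the plateau cube. [cite: Balaban1983RegularityDecay, §2 p.575] -/
theorem mem_plateau_of_supp {M : ℝ} (hM : 0 < M) (pos : X → ι → ℝ) {j : ι → ℤ} {z' : X}
    (hz' : hCube M j (pos z') ≠ 0) (μ : ι) : |pos z' μ - M * j μ| ≤ 3 / 4 * M :=
  mem_plateau_of_near_supp hM pos hz' (fun μ => by rw [sub_self, abs_zero]; positivity) μ

/-- **(2.6) FOR THE CONCRETE `h_j`** (`B4PartitionUnity22.hCube M j ∘ pos` on any finite site set `X` with positions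
`pos : X → ℝ^d`): `H·h_j = H′·h_j` for the operators (1.6) of two data sets `(c, W, q, T)`, `(c′, W′, q′, T′)` provided
(i) the bond weights are LOCAL at scale `(1/8)M` (`c(x,z′) ≠ 0 ⇒ |pos x − pos z′|_∞ ≤ M/8`), and (ii) the two data sets AGREE ON THE PLATEAU CUBE `{|x_μ − Mj_μ| ≤ (3/4)M}` around `Mj`: bond weights
at plateau sites, links between plateau sites, and every averaging block meeting `supp h_j` (weights, and transporters
where the weight is nonzero — such blocks lie inside the plateau).  In
[B4]: `(c′, q′)` = the Neumann data of `□_j ⊇` plateau (bonds/blocks inside `□_j` unchanged) and `(W′, T′)` = links and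
transporters of `Ã_j = A₀ + θ_jA′ = A` on the plateau («we take Ã_j as equal to A on the cube {x : |x − Mj| ≤ ¾M}»,
p. 575). [cite: Balaban1983RegularityDecay, (2.6) p.576] -/
theorem covOp_mul_mulH_hCube_congr {M : ℝ} (hM : 0 < M) (pos : X → ι → ℝ) (j : ι → ℤ)
    {c c' : X → X → ℝ} {W W' : X → X → Matrix κ κ ℝ} {q q' : Y → X → ℝ} {T T' : Y → X → Matrix κ κ ℝ}
    (m2 a : ℝ)
    (hc : ∀ x z', c x z' ≠ 0 → ∀ μ, |pos x μ - pos z' μ| ≤ 1 / 8 * M)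
    (hcc' : ∀ x z', (∀ μ, |pos z' μ - M * j μ| ≤ 3 / 4 * M) → c' x z' = c x z' ∧ c' z' x = c z' x)
    (hWW' : ∀ x z', (∀ μ, |pos x μ - M * j μ| ≤ 3 / 4 * M) → (∀ μ, |pos z' μ - M * j μ| ≤ 3 / 4 * M) →
      W' x z' = W x z')
    (hqq' : ∀ y, (∃ z', q y z' ≠ 0 ∧ hCube M j (pos z') ≠ 0) →
      ∀ x, q' y x = q y x ∧ (q y x ≠ 0 → T' y x = T y x))
    (hq'q : ∀ y z', q' y z' ≠ 0 → hCube M j (pos z') ≠ 0 → q y z' ≠ 0) :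
    covOp c m2 a q W T * mulH (ι := κ) (fun z => hCube M j (pos z))
      = covOp c' m2 a q' W' T' * mulH (ι := κ) (fun z => hCube M j (pos z)) := by
  refine covOp_mul_mulH_congr m2 a _ ?_ ?_ ?_
  · intro z' hz' x
    have hpl := mem_plateau_of_supp hM pos hz'
    exact ⟨(hcc' x z' hpl).1.symm, (hcc' x z' hpl).2.symm⟩
  · intro z' hz' x
    have hpl := mem_plateau_of_supp hM pos hz'
    constructor
    · intro hx
      exact (hWW' x z' (mem_plateau_of_near_supp hM pos hz' (hc x z' hx)) hpl).symm
    · intro hx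
      refine (hWW' z' x hpl (mem_plateau_of_near_supp hM pos hz' fun μ => ?_)).symm
      rw [abs_sub_comm]
      exact hc z' x hx μ
  · intro y z' hz' hy x
    have hyq : q y z' ≠ 0 := by
      rcases hy with hy | hy
      · exact hy
      · exact hq'q y z' hy hz'
    have hag := hqq' y ⟨z', hyq, hz'⟩ x
    exact ⟨hag.1.symm, fun hx => (hag.2 hx).symm⟩

omit [Fintype X] [DecidableEq X] [Fintype ι] in
/-- THE NEUMANN CUT at a site set `S` (in [B4]: the sites of `□_j`): the weights `1[z ∈ S ↔ z′ ∈ S]·c(z,z′)` (bonds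
crossing `∂S` dropped; `−Δ` decouples into `S` and its complement) AGREE with `c` at every plateau site, provided
`S` contains the `(7/8)M`-cube around `Mj` and the bonds have range `≤ M/8` — «h_j can be ≠ 0 only on the part of the
boundary of □_j which is contained in the boundary of Ω». [cite: Balaban1983RegularityDecay, (2.6) p.576] -/
theorem neumannCut_agrees {M : ℝ} (pos : X → ι → ℝ) (j : ι → ℤ) (c : X → X → ℝ)
    (S : X → Prop) [DecidablePred S] (hS : ∀ z, (∀ μ, |pos z μ - M * j μ| ≤ 7 / 8 * M) → S z)
    (hc : ∀ x z', c x z' ≠ 0 → ∀ μ, |pos x μ - pos z' μ| ≤ 1 / 8 * M) (x z' : X)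
    (hz' : ∀ μ, |pos z' μ - M * j μ| ≤ 3 / 4 * M) :
    (if (S x ↔ S z') then c x z' else 0) = c x z' ∧ (if (S z' ↔ S x) then c z' x else 0) = c z' x := by
  have hSz' : S z' := hS z' fun μ => (hz' μ).trans (by
    have := (abs_nonneg _).trans (hz' μ)
    nlinarith)
  have near : ∀ x, (∀ μ, |pos x μ - pos z' μ| ≤ 1 / 8 * M) → S x := by
    intro x hx
    apply hS
    intro μ
    calc |pos x μ - M * j μ| = |(pos x μ - pos z' μ) + (pos z' μ - M * j μ)| := by ring_nf
      _ ≤ |pos x μ - pos z' μ| + |pos z' μ - M * j μ| := abs_add_le _ _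
      _ ≤ 7 / 8 * M := by linarith [hx μ, hz' μ]
  constructor
  · by_cases h0 : c x z' = 0
    · rw [h0]; exact ite_self 0
    · rw [if_pos (iff_of_true (near x (hc x z' h0)) hSz')]
  · by_cases h0 : c z' x = 0
    · rw [h0]; exact ite_self 0
    · rw [if_pos (iff_of_true hSz' (near x fun μ => by rw [abs_sub_comm]; exact hc z' x h0 μ))]

/-- **(2.6) AS PRINTED, for the concrete `h_j`**: `(−Δ^{η,N}_{A,Ω} + m² + aP(A))·h_j = (−Δ^{η,N}_{Ã_j,□_j} + m² + aP(Ã_j))·h_j`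
with `□_j` = any site set `S` containing the `(7/8)M`-cube around `Mj` (Neumann cut of the bond weights at `∂S`),
`Ã_j` = any links/transporters `W′, T′` agreeing with `W, T` on the plateau `{|x − Mj|_∞ ≤ (3/4)M}`, the averaging
blocks unchanged; data local at scale `M/8`.  This is the hypothesis `hloc` of `B4Commutators25to211.parametrix_identity`
for [B4]'s `G₀ = Σ_j h_jG_k(□_j,Ã_j)h_j` (2.2) with the concrete partition of unity (its `hsum` is
`B4PartitionUnity22.sum_mulH_hCube_sq_eq_one`). [cite: Balaban1983RegularityDecay, (2.6) p.576] -/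
theorem eq26_hCube {M : ℝ} (hM : 0 < M) (pos : X → ι → ℝ) (j : ι → ℤ) (c : X → X → ℝ) (m2 a : ℝ)
    (q : Y → X → ℝ) {W W' : X → X → Matrix κ κ ℝ} {T T' : Y → X → Matrix κ κ ℝ}
    (S : X → Prop) [DecidablePred S] (hS : ∀ z, (∀ μ, |pos z μ - M * j μ| ≤ 7 / 8 * M) → S z)
    (hc : ∀ x z', c x z' ≠ 0 → ∀ μ, |pos x μ - pos z' μ| ≤ 1 / 8 * M)
    (hqr : ∀ y x z', q y x ≠ 0 → q y z' ≠ 0 → ∀ μ, |pos x μ - pos z' μ| ≤ 1 / 8 * M)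
    (hWW' : ∀ x z', (∀ μ, |pos x μ - M * j μ| ≤ 3 / 4 * M) → (∀ μ, |pos z' μ - M * j μ| ≤ 3 / 4 * M) →
      W' x z' = W x z')
    (hTT' : ∀ y x, q y x ≠ 0 → (∀ μ, |pos x μ - M * j μ| ≤ 3 / 4 * M) → T' y x = T y x) :
    covOp c m2 a q W T * mulH (ι := κ) (fun z => hCube M j (pos z))
      = covOp (fun z z' => if (S z ↔ S z') then c z z' else 0) m2 a q W' T'
          * mulH (ι := κ) (fun z => hCube M j (pos z)) := by
  refine covOp_mul_mulH_hCube_congr hM pos j m2 a hc (fun x z' hz' => neumannCut_agrees pos j c S hS hc x z' hz')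
    hWW' ?_ (fun y z' h _ => h)
  rintro y ⟨z', hyz', hz'⟩ x
  exact ⟨rfl, fun hx => hTT' y x hx (mem_plateau_of_near_supp hM pos hz' (hqr y x z' hx hyz'))⟩

/-! ## §3. The parametrix identity (2.9)–(2.11) `H·G₀ = 1 − R` for [B4]'s concrete `G₀ = Σ_j h_jG_k(□_j,Ã_j)h_j` -/

/-- **(2.9)–(2.11) ⇒ `H_k(Ω,A)·G₀ = 1 − R` FOR THE CONCRETE DATA** — `B4Commutators25to211.parametrix_identity` with BOTH
structural hypotheses DISCHARGED: `hsum` («Σ_j h_j² = 1») by `B4PartitionUnity22.sum_mulH_hCube_sq_eq_one` and `hloc`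
((2.6)) by `eq26_hCube`, for every label set `s ⊇ {j : h_j ≠ 0 on X}`, every family of cube site-sets `S j ⊇` the
`(7/8)M`-cube around `Mj` (Neumann cut `□_j`), every family of link/transporter data `W′ j, T′ j` agreeing with `W, T`
on the plateau of `j` (`Ã_j = A` there), and data local at scale `M/8`; the ONLY remaining hypothesis is the
invertibility `H_j·G_j = 1` of the cube operators (`G_j = G_k(□_j,Ã_j)`).  Conclusion:
`H·Σ_j h_jG_jh_j = 1 − Σ_j K_jG_jh_j` with `K_j = [h_j, H_j]` (2.10), i.e. (2.11) `R = Σ_j K_jG_k(□_j,Ã_j)h_j`.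
[cite: Balaban1983RegularityDecay, (2.9)–(2.11) p.576] -/
theorem parametrix_identity_hCube {M : ℝ} (hM : 0 < M) (pos : X → ι → ℝ) (c : X → X → ℝ) (m2 a : ℝ)
    (q : Y → X → ℝ) (W : X → X → Matrix κ κ ℝ) (T : Y → X → Matrix κ κ ℝ)
    (s : Finset (ι → ℤ)) (hs : ∀ j x, hCube M j (pos x) ≠ 0 → j ∈ s)
    (S : (ι → ℤ) → X → Prop) [∀ j, DecidablePred (S j)]
    (hS : ∀ j z, (∀ μ, |pos z μ - M * j μ| ≤ 7 / 8 * M) → S j z)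
    (hc : ∀ x z', c x z' ≠ 0 → ∀ μ, |pos x μ - pos z' μ| ≤ 1 / 8 * M)
    (hqr : ∀ y x z', q y x ≠ 0 → q y z' ≠ 0 → ∀ μ, |pos x μ - pos z' μ| ≤ 1 / 8 * M)
    (W' : (ι → ℤ) → X → X → Matrix κ κ ℝ) (T' : (ι → ℤ) → Y → X → Matrix κ κ ℝ)
    (hWW' : ∀ j x z', (∀ μ, |pos x μ - M * j μ| ≤ 3 / 4 * M) → (∀ μ, |pos z' μ - M * j μ| ≤ 3 / 4 * M) →
      W' j x z' = W x z')
    (hTT' : ∀ j y x, q y x ≠ 0 → (∀ μ, |pos x μ - M * j μ| ≤ 3 / 4 * M) → T' j y x = T y x)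
    (G : (ι → ℤ) → Matrix (X × κ) (X × κ) ℝ)
    (hG : ∀ j ∈ s, covOp (fun z z' => if (S j z ↔ S j z') then c z z' else 0) m2 a q (W' j) (T' j) * G j = 1) :
    covOp c m2 a q W T * ∑ j ∈ s, mulH (ι := κ) (fun z => hCube M j (pos z)) * G j
        * mulH (ι := κ) (fun z => hCube M j (pos z))
      = 1 - ∑ j ∈ s, opK (fun z z' => if (S j z ↔ S j z') then c z z' else 0) m2 a q (W' j) (T' j)
          (fun z => hCube M j (pos z)) * G j * mulH (ι := κ) (fun z => hCube M j (pos z)) := by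
  have h := parametrix_identity s (covOp c m2 a q W T)
    (fun j => covOp (fun z z' => if (S j z ↔ S j z') then c z z' else 0) m2 a q (W' j) (T' j)) G
    (fun j z => hCube M j (pos z))
    (fun j _ => eq26_hCube hM pos j c m2 a q (S j) (hS j) hc hqr (hWW' j) (hTT' j)) hG
    (sum_mulH_hCube_sq_eq_one M pos s hs)
  simpa only [opK] using h

end Literature.MathematicalPhysics.QuantumFieldTheory.Balaban1983to89.B4Eq26Locality
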